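import Literature.NumberTheory.Automorphic.SymplecticSatakeTransform
import Literature.NumberTheory.Automorphic.SatakeTransformIwasawaInjective
import Literature.NumberTheory.Automorphic.SymplecticIwasawaCartan
import Literature.NumberTheory.Automorphic.HyperspecialUnitarySatakeInjective
import HarnessLib

/-!
# The Satake transform of `ℋ(Sp_{2n}(K), Sp_{2n}(𝒪))` is injective, and `𝒮(T_{d(a)})` is triangular
# (Cartier 1979, Thm. 4.1, injectivity half, for the symplectic group; via Bruhat–Tits (4.4.4) (i))

Topic `NumberTheory/Automorphic`; namespace `Literature.NumberTheory.Automorphic.SymplecticCartan` (lane `lit-hodgefound`,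
Track 2 foundations; seat `lit-hodgefound-p11`, generation 37, row g37-#12).  THEOREMS ONLY: no definition, no named fact,
no instance, no notation.  Assembles `SymplecticSatakeTransform` (`symplecticSatakeTransform hϖ q : ℋ →ₐ[R] R[ℤⁿ]`, an
algebra homomorphism), the abstract criterion `SatakeTransformIwasawaInjective` ((CARTAN) + (SEPARATION) + (DOMINANCE) ⇒
injective) and `SymplecticIwasawaCartan` (Bruhat–Tits (4.4.4) (i) for `Sp_{2n}`), with the head-sum/lexicographic refinement
of the dominance order from `HyperspecialUnitarySatakeInjective` §1.

## The print

[CartierCorvallis1979] §IV Thm. 4.1: «The Satake transform is an algebra isomorphism of `ℋ(G, K)` onto `ℂ[Λ]^W`»; proof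
(b)–(c): the `Sc_λ` are triangular with non-zero leading coefficient, hence linearly independent — for `G = Sp_{2n}(K)`,
`K = Sp_{2n}(𝒪)`; [Satake1963] §6, §7.2 (the symplectic group); [BruhatTits1972] Prop. (4.4.4); [AndrianovZhuravlev1995]
Ch. 3 §3.3 Thm. 3.30 (the spherical map `Ω` of the Hecke ring of `Sp_n` is injective — there with the explicit image).  The
SURJECTIVITY onto the Weyl-group invariants is NOT claimed.

## What is formalised (`K` a field with `Valued K ℤᵐ⁰`, uniformiser `ϖ`; `R` a commutative ring, `q ∈ Rˣ`)

* §1 the three hypotheses of the abstract criterion for the datum `(B(K), Sp(J, 𝒪), symplecticIwasawaExp)` with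
  `D = {d(a) : a antitone}` and `φ = ` head sums in `Lex (Fin n → ℤ)`: `exists_cartanDiagonal_mem_orbit` (CARTAN),
  `injOn_symplecticIwasawaExp_cartanDiagonal` (SEPARATION), **`symplecticIwasawaExp_eq_or_headSum_lt`** (DOMINANCE, from
  `sum_symplecticIwasawaExp_head_le`).
* §2 **`symplecticSatakeTransform_injective`** — for `R` a domain of characteristic `0` and any `q ∈ Rˣ`,
  `symplecticSatakeTransform hϖ q` IS INJECTIVE; `eq_zero_of_symplecticSatakeVec_eq_zero` (a non-zero `Sp(J, 𝒪)`-invariant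
  vector has non-zero transform).
* §3 TRIANGULARITY: **`headSum_le_of_coeff_symplecticSatakeTransform_ne_zero`** (`x^μ` occurs in `𝒮(T_{d(a)})` only if
  `Σ_{i<r} μᵢ ≤ Σ_{i<r} aᵢ` for all `r`), `coeff_self_symplecticSatakeTransform_cartanDiagonal_ne_zero` (the leading
  coefficient, that of `x^a`, is non-zero).

## References
* [CartierCorvallis1979] P. Cartier, *Representations of 𝔭-adic groups: a survey*, PSPM 33.1 (1979), §IV Thm. 4.1 and proof.
* [Satake1963] I. Satake, Publ. Math. IHÉS 18 (1963), §6, §7.2.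
* [BruhatTits1972] F. Bruhat, J. Tits, Publ. Math. IHÉS 41 (1972), Prop. (4.4.4).
* [AndrianovZhuravlev1995] A. N. Andrianov, V. G. Zhuravlev, *Modular Forms and Hecke Operators* (1995), Ch. 3 §3.3 Thm. 3.30.
-/

noncomputable section

open scoped Valued WithZero MatrixGroups
open Matrix MonoidAlgebra Representation Finset

namespace Literature.NumberTheory.Automorphic.SymplecticCartan

open Literature.NumberTheory.Automorphic.CartanUnique Literature.NumberTheory.Automorphic.HermitianLattice

variable {K : Type*} [Field K] [Valued K ℤᵐ⁰] {ϖ : K} {n : ℕ}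

/-! ## §1 (CARTAN), (SEPARATION), (DOMINANCE) for `Sp_{2n}` -/

/-- **(CARTAN)**: every coset `γ₀ ∈ Sp(J, K)/Sp(J, 𝒪)` has some `d(a)Sp(J, 𝒪)`, `a` antitone, in its `Sp(J, 𝒪)`-orbit.
[cite: BruhatTits1972, §4.4 (4.4.3)] [cite: AndrianovZhuravlev1995, Ch. 3 §3 Lemma 3.6] -/
theorem exists_cartanDiagonal_mem_orbit (hϖ : Valued.v ϖ = WithZero.exp (-1 : ℤ))
    (γ₀ : symplecticGroup (Fin n) K ⧸ symplecticInt (Fin n) K) :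
    ∃ t ∈ {t : symplecticGroup (Fin n) K | ∃ a : Fin n → ℕ, Antitone a ∧
        t = ⟨Matrix.diagonal (Sum.elim (fun i => ϖ ^ a i) (fun i => (ϖ ^ a i)⁻¹)),
          diagonal_pow_mem_symplecticGroup (CartanUnique.uniformizer_ne_zero hϖ) a⟩},
      (t : symplecticGroup (Fin n) K ⧸ symplecticInt (Fin n) K) ∈ MulAction.orbit (symplecticInt (Fin n) K) γ₀ := by
  obtain ⟨a, ha, h⟩ := exists_antitone_mem_orbit hϖ γ₀
  exact ⟨_, ⟨a, ha, rfl⟩, h⟩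

/-- **(SEPARATION)**: `d(a) ↦ a(d(a)) = a` is injective on the Cartan representatives.
[cite: BruhatTits1972, Prop. (4.4.4) (ii)] -/
theorem injOn_symplecticIwasawaExp_cartanDiagonal (hϖ : Valued.v ϖ = WithZero.exp (-1 : ℤ)) :
    Set.InjOn (symplecticIwasawaExp hϖ) {t : symplecticGroup (Fin n) K | ∃ a : Fin n → ℕ, Antitone a ∧
        t = ⟨Matrix.diagonal (Sum.elim (fun i => ϖ ^ a i) (fun i => (ϖ ^ a i)⁻¹)),
          diagonal_pow_mem_symplecticGroup (CartanUnique.uniformizer_ne_zero hϖ) a⟩} := by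
  rintro _ ⟨a, -, rfl⟩ _ ⟨a', -, rfl⟩ h
  rw [symplecticIwasawaExp_diagonal, symplecticIwasawaExp_diagonal] at h
  have haa' : a = a' := funext fun i => by exact_mod_cast congr_fun h i
  subst haa'
  rfl

/-- Head sums of an `ℕ`-valued vector, cast. [cite: BruhatTits1972, Prop. (4.4.4)] -/
theorem natCast_headSum (a : Fin n → ℕ) (r : ℕ) :
    ((∑ i : Fin n, if (i : ℕ) < r then a i else 0 : ℕ) : ℤ) = ∑ i : Fin n, if (i : ℕ) < r then (a i : ℤ) else 0 := by
  rw [Nat.cast_sum]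
  exact Finset.sum_congr rfl fun i _ => apply_ite (fun x : ℕ => (x : ℤ)) _ _ _

/-- **(DOMINANCE)** — Bruhat–Tits (4.4.4) (i) in the form used by the abstract criterion: for a coset `γ ⊆ K₀ d(a) K₀`
(`a` antitone) either `a(γ) = a` or the head-sum vector of `a(γ)` is lexicographically SMALLER than that of `a`.
[cite: BruhatTits1972, Prop. (4.4.4) (i)] [cite: CartierCorvallis1979, §IV, proof of Thm. 4.1 (c)] -/
theorem symplecticIwasawaExp_eq_or_headSum_lt (hϖ : Valued.v ϖ = WithZero.exp (-1 : ℤ)) :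
    ∀ t ∈ {t : symplecticGroup (Fin n) K | ∃ a : Fin n → ℕ, Antitone a ∧
        t = ⟨Matrix.diagonal (Sum.elim (fun i => ϖ ^ a i) (fun i => (ϖ ^ a i)⁻¹)),
          diagonal_pow_mem_symplecticGroup (CartanUnique.uniformizer_ne_zero hϖ) a⟩},
      ∀ γ ∈ MulAction.orbit (symplecticInt (Fin n) K) (t : symplecticGroup (Fin n) K ⧸ symplecticInt (Fin n) K),
        symplecticIwasawaExp hϖ γ.out = symplecticIwasawaExp hϖ t ∨
          toLex (fun r : Fin n => ∑ i : Fin n, if (i : ℕ) < (r : ℕ) + 1 then symplecticIwasawaExp hϖ γ.out i else 0) <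
            toLex (fun r : Fin n => ∑ i : Fin n, if (i : ℕ) < (r : ℕ) + 1 then symplecticIwasawaExp hϖ t i else 0) := by
  rintro _ ⟨a, ha, rfl⟩ γ hγ
  rw [symplecticIwasawaExp_diagonal]
  have hγ' : (γ.out : symplecticGroup (Fin n) K ⧸ symplecticInt (Fin n) K) ∈ MulAction.orbit (symplecticInt (Fin n) K)
      (((⟨Matrix.diagonal (Sum.elim (fun i => ϖ ^ a i) (fun i => (ϖ ^ a i)⁻¹)),
          diagonal_pow_mem_symplecticGroup (CartanUnique.uniformizer_ne_zero hϖ) a⟩ : symplecticGroup (Fin n) K)) :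
        symplecticGroup (Fin n) K ⧸ symplecticInt (Fin n) K) := by
    rwa [QuotientGroup.out_eq']
  have hle : ∀ r : ℕ, (∑ i : Fin n, if (i : ℕ) < r then symplecticIwasawaExp hϖ γ.out i else 0) ≤
      ∑ i : Fin n, if (i : ℕ) < r then (a i : ℤ) else 0 := fun r => by
    rw [← natCast_headSum]
    exact sum_symplecticIwasawaExp_head_le hϖ ha hγ' r
  rcases (toLex_headSum_le_of_forall_le hle).lt_or_eq with hlt | heq
  · exact Or.inr hlt
  · exact Or.inl (eq_of_forall_le_of_toLex_le hle heq.ge)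

/-! ## §2 Injectivity -/

variable {R : Type*} [CommRing R]

/-- **THE SATAKE TRANSFORM OF `ℋ(Sp_{2n}(K), Sp_{2n}(𝒪))` IS INJECTIVE** over any domain of characteristic `0`, for every
normalisation `q ∈ Rˣ` (the injectivity half of the Satake isomorphism for the symplectic group; the abstract criterion
`IsIwasawaExponent.satakeTransform_injective` fed with (CARTAN), (SEPARATION), (DOMINANCE) above).
[cite: CartierCorvallis1979, §IV Thm. 4.1] [cite: BruhatTits1972, Prop. (4.4.4) (i)] [cite: AndrianovZhuravlev1995, Ch. 3 §3.3 Thm. 3.30] -/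
theorem symplecticSatakeTransform_injective [IsDomain R] [CharZero R] (hϖ : Valued.v ϖ = WithZero.exp (-1 : ℤ)) (q : Rˣ) :
    Function.Injective (symplecticSatakeTransform (n := n) (R := R) hϖ q) :=
  (isIwasawaExponent_symplectic hϖ).satakeTransform_injective (symplecticSatakeWeight q)
    (φ := fun μ : Fin n → ℤ => toLex (fun r : Fin n => ∑ i : Fin n, if (i : ℕ) < (r : ℕ) + 1 then μ i else 0))
    (exists_cartanDiagonal_mem_orbit hϖ) (injOn_symplecticIwasawaExp_cartanDiagonal hϖ)
    (symplecticIwasawaExp_eq_or_headSum_lt hϖ)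

/-- **A non-zero `Sp(J, 𝒪)`-invariant vector has non-zero Satake transform.** [cite: CartierCorvallis1979, §IV Thm. 4.1, proof (b)–(c)] -/
theorem eq_zero_of_symplecticSatakeVec_eq_zero [IsDomain R] [CharZero R] (hϖ : Valued.v ϖ = WithZero.exp (-1 : ℤ))
    (q : Rˣ) {v : MonoidAlgebra R (symplecticGroup (Fin n) K ⧸ symplecticInt (Fin n) K)}
    (hv : ∀ k ∈ symplecticInt (Fin n) K,
      ofMulAction R (symplecticGroup (Fin n) K) (symplecticGroup (Fin n) K ⧸ symplecticInt (Fin n) K) k v = v)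
    (h0 : IsIwasawaExponent.satakeVec (symplecticInt (Fin n) K) (symplecticIwasawaExp hϖ) (symplecticSatakeWeight q) v = 0) :
    v = 0 :=
  (isIwasawaExponent_symplectic hϖ).eq_zero_of_satakeVec_eq_zero (symplecticSatakeWeight q)
    (φ := fun μ : Fin n → ℤ => toLex (fun r : Fin n => ∑ i : Fin n, if (i : ℕ) < (r : ℕ) + 1 then μ i else 0))
    (exists_cartanDiagonal_mem_orbit hϖ) (injOn_symplecticIwasawaExp_cartanDiagonal hϖ)
    (symplecticIwasawaExp_eq_or_headSum_lt hϖ) hv h0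

/-! ## §3 Triangularity of `𝒮(T_{d(a)})` -/

variable [IsHeckeTriple (⊤ : Submonoid (symplecticGroup (Fin n) K)) (symplecticInt (Fin n) K) (symplecticInt (Fin n) K)]

/-- **Triangularity**: if `x^μ` occurs in `𝒮(T_{d(a)})` (`a` antitone) then `μ` is dominated by `a`:
`Σ_{i<r} μᵢ ≤ Σ_{i<r} aᵢ` for every `r` — Cartier's «`c(λ, μ) = 0` unless `μ ≤ λ`».
[cite: CartierCorvallis1979, §IV, proof of Thm. 4.1 (c)] [cite: BruhatTits1972, Prop. (4.4.4) (i)] -/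
theorem headSum_le_of_coeff_symplecticSatakeTransform_ne_zero (hϖ : Valued.v ϖ = WithZero.exp (-1 : ℤ)) (q : Rˣ)
    {a : Fin n → ℕ} (ha : Antitone a) {μ : Fin n → ℤ}
    (hμ : (symplecticSatakeTransform hϖ q (heckeAlgebra.doubleCosetOperator (symplecticInt (Fin n) K)
      (⟨Matrix.diagonal (Sum.elim (fun i => ϖ ^ a i) (fun i => (ϖ ^ a i)⁻¹)),
        diagonal_pow_mem_symplecticGroup (CartanUnique.uniformizer_ne_zero hϖ) a⟩ : symplecticGroup (Fin n) K))).coeff μ ≠ 0)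
    (r : ℕ) :
    (∑ i : Fin n, if (i : ℕ) < r then μ i else 0) ≤ ∑ i : Fin n, if (i : ℕ) < r then (a i : ℤ) else 0 := by
  by_contra hlt
  refine hμ ((isIwasawaExponent_symplectic hϖ).coeff_satakeTransform_doubleCosetOperator_eq_zero _ fun γ hγ heq => ?_)
  have hγ' : (γ.out : symplecticGroup (Fin n) K ⧸ symplecticInt (Fin n) K) ∈ MulAction.orbit (symplecticInt (Fin n) K)
      (((⟨Matrix.diagonal (Sum.elim (fun i => ϖ ^ a i) (fun i => (ϖ ^ a i)⁻¹)),
          diagonal_pow_mem_symplecticGroup (CartanUnique.uniformizer_ne_zero hϖ) a⟩ : symplecticGroup (Fin n) K)) :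
        symplecticGroup (Fin n) K ⧸ symplecticInt (Fin n) K) := by
    rwa [QuotientGroup.out_eq']
  have h := sum_symplecticIwasawaExp_head_le hϖ ha hγ' r
  rw [heq, natCast_headSum] at h
  exact hlt h

/-- **The leading coefficient of `𝒮(T_{d(a)})`**, that of `x^a`, is `#{γ ⊆ K₀d(a)K₀ : a(γ) = a} · q^{⟨ρ, a⟩} ≠ 0` over a
domain of characteristic `0`. [cite: CartierCorvallis1979, §IV, proof of Thm. 4.1 (c)] [cite: BruhatTits1972, Prop. (4.4.4) (ii)] -/
theorem coeff_self_symplecticSatakeTransform_cartanDiagonal_ne_zero [IsDomain R] [CharZero R]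
    (hϖ : Valued.v ϖ = WithZero.exp (-1 : ℤ)) (q : Rˣ) (a : Fin n → ℕ) :
    (symplecticSatakeTransform hϖ q (heckeAlgebra.doubleCosetOperator (symplecticInt (Fin n) K)
      (⟨Matrix.diagonal (Sum.elim (fun i => ϖ ^ a i) (fun i => (ϖ ^ a i)⁻¹)),
        diagonal_pow_mem_symplecticGroup (CartanUnique.uniformizer_ne_zero hϖ) a⟩ : symplecticGroup (Fin n) K))).coeff
        (fun i => (a i : ℤ)) ≠ 0 := by
  rw [← symplecticIwasawaExp_diagonal hϖ a]
  exact (isIwasawaExponent_symplectic hϖ).coeff_self_satakeTransform_doubleCosetOperator_ne_zero _ _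

end Literature.NumberTheory.Automorphic.SymplecticCartan

end
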